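import Summits.ResolutionOfSingularities.ResolutionOfSingularities.Theorems.HilbertSamuelEliminationSigmaMaxModificationsCorridor3SigmaMenuSurfacePhase
import Summits.ResolutionOfSingularities.ResolutionOfSingularities.Theorems.HilbertSamuelEliminationSigmaMaxModificationsCorridor3SigmaBoundaryOnSurfaceList
import HarnessLib

/-!
# [OURS · L1 W4.2] σ-LAYER — `Corridor3SigmaMenuSurfacePrep`: the (P1*) PREP ORACLE OF RECORD as a COMBINATOR of its three sub-oracles — PHASE S
# (surface not yet regular), the CURE curve step (regular surface, bad trace list: `M > 0`), the F-75 POINT step (regular, `M = 0`, not yet ready) —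
# by the case rule of CRUX-PLAN v3.13b (4); its stratum-discipline obligations split accordingly; and the (P1) tier of record
# `surfacePhaseOfRecord Ready phaseS bad cure point := surfacePhase Ready (SurfacePrep.ofRecord regular phaseS bad cure point)`
# (res-L1-w42-plan-1 RULINGS v3.14-35 (HS)/(HT), -36 (IA) «prep_ofRecord := the rule of CRUX-PLAN v3.13b (4)»; crux chain w42 `SigmaMaxModifications`
# stmt-ResolutionOfSingularities-18506 / conjunct `SigmaMaxModificationsCorridor3` stmt-ResolutionOfSingularities-19249; typer res-L1-type-o1 (OURS typer G4);
# `--supports stmt-…-19249 --as helper`, counted 0)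

HONEST FRAMING. OURS design bookkeeping over `…SigmaMenuSurfacePhase` (p540556). The three SUB-ORACLES are PARAMETERS (suppliers: PHASE S = the F-72
canonical step truncated at «regular» — res-type-001/067; CURE = the curve step along the key-least bad filtered-trace component — res-type-067's LAYER 2
`…SigmaBoundaryOnSurfaceList` (`SncListOn`, `IsNCListWithOn`, trace multiplicities); POINT = the first centre of a shortest resolving point-composition —
res-L1-w42-stub-1's ℓ-glue over F-75 `Stacks0BIC_embeddedResolutionCurvesInSurfaces`), as are the REGULARITY reading and the BADNESS count `M`. This file
fixes the CASE RULE and splits the discipline obligation; NOTHING here is a statement of H. Hironaka's manuscript [Hironaka2017] nor of Cossart–Jannsen–Saito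
[CossartJannsenSaito2020]; no named fact; AI-typed, AI review is weaker than expert review.

## Contents (namespace `…Theorems.SigmaMaxModificationsCorridor3.Sigma`)

* `SurfaceRegularity` (state-free reading «the surface `D` is regular» — instance `Scheme.IsRegular (menuCentre D).subscheme`), `SurfaceBadness` (the count
  `M(E, D)` of shared / non-reduced filtered-trace components), **`SurfacePrep.ofRecord regular phaseS bad cure point : SurfacePrep`** — the case rule:
  `¬ regular D` ⇒ PHASE S's centre; `regular D ∧ 0 < M` ⇒ the CURE curve; `regular D ∧ M = 0` ⇒ the POINT step (readiness is the (P1) tier's own test: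
  a READY surface is blown up by `surfaceProposal`'s first branch and never reaches `prep`).
* `SurfacePrep.ofRecord_cases` (unfolding), **`SurfacePrep.ofRecord_regular_subset`** (the `hprep` obligation of `surfacePhase_isStratumDisciplined` for the
  combined oracle follows from the three sub-oracles' «centre regular ∧ ⊆ X(ν)» — PHASE S centres ⊆ Sing D ⊆ D, cure curves and F-75 points ⊆ D̃ ⊆ X(ν),
  res-type-001's (c1)–(c3) p536502), **`StrategyE.surfacePhaseOfRecord`** := `surfacePhase Ready (SurfacePrep.ofRecord …)` + `_isFunctional`,
  **`surfacePhaseOfRecord_isStratumDisciplined`**; and WITH THE READINESS OF RECORD (res-type-067's `ReadyOfRecord`, p540435):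
  **`StrategyE.surfacePhaseReady`** + `_isFunctional` + **`surfacePhaseReady_isStratumDisciplined`** (the `hReady` half DISCHARGED by `ReadyOfRecord.isRegular`;
  only the three sub-oracles' «centre regular ∧ ⊆ X(ν)» remain as hypotheses).
* **`StrategyE.betweenCycles π`** — the policy SILENT while a CJS cycle is pending (`P = none` guard; cycle atomicity for the (L-A) socket
  `TauRecurrentWaitingImpossible` of res-L1-w42-stub-4's p540926): `betweenCycles_step_iff/_step_imp/_silent_of_pending/_exists_step_iff`,
  `IsFunctional.betweenCycles`, `IsDisciplinedBy.betweenCycles`, `IsStratumDisciplined.betweenCycles`.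

VACUITY SELF-CHECK. Definitions + one-line consequences; the case rule is exhaustive on non-ready surfaces by construction (`regular ∨ ¬ regular`,
`M = 0 ∨ 0 < M`), so `ofRecord` proposes wherever the relevant sub-oracle does (`ofRecord_of_phaseS/_of_cure/_of_point`).
-/

noncomputable section

set_option linter.dupNamespace false -- mandated namespace of this single-conjunct summit

open CategoryTheory AlgebraicGeometry TopologicalSpace
open Summit.ResolutionOfSingularities.ResolutionOfSingularities.Theorems.CampaignW42
open Literature.AlgebraicGeometry.Resolution Literature.RingTheory.HilbertSamuel

namespace Summit.ResolutionOfSingularities.ResolutionOfSingularities.Theorems.SigmaMaxModificationsCorridor3.Sigma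

universe u

/-- [OURS · L1 W4.2] **A SURFACE REGULARITY READING** (instance: `Scheme.IsRegular (menuCentre D).subscheme` — PHASE S's exit test). [folklore] -/
abbrev SurfaceRegularity : Type (u + 1) :=
  ∀ (W : Scheme.{u}), Closeds W → Prop

/-- [OURS · L1 W4.2] **A SURFACE BADNESS COUNT** `M(E, D)` (instance: `Σ_c (Σ_j mult_c Γ_j − 1)` over the shared / non-reduced components of the filtered
trace list `E.restrictOff ι_D` — CRUX-PLAN v3.13b (4); `M = 0` iff the trace LIST is reduced with pairwise distinct components). [folklore] -/
abbrev SurfaceBadness : Type (u + 1) :=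
  ∀ (W : Scheme.{u}), Boundary W → Closeds W → ℕ

section Prep

variable (regular : SurfaceRegularity.{u}) (phaseS : SurfacePrep.{u}) (bad : SurfaceBadness.{u}) (cure point : SurfacePrep.{u})

/-- [OURS · L1 W4.2] **THE (P1*) PREP ORACLE OF RECORD, assembled by the case rule** (CRUX-PLAN v3.13b (4)): for a (non-ready) surface component `D`
at the state — if `D` is NOT regular, PHASE S proposes (the CJS dimension-2 canonical centre, F-72 truncated at «regular»); if `D` is regular and its
filtered trace list is BAD (`0 < M`), the CURE curve step proposes; if `D` is regular with `M = 0`, the F-75 POINT step proposes (first centre of a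
shortest resolving point-composition). NOT a statement of the manuscript. [folklore] -/
def SurfacePrep.ofRecord : SurfacePrep.{u} :=
  fun W hW N ν L P E D C =>
    (¬ regular W D ∧ phaseS W hW N ν L P E D C) ∨
      (regular W D ∧ 0 < bad W E D ∧ cure W hW N ν L P E D C) ∨
        (regular W D ∧ bad W E D = 0 ∧ point W hW N ν L P E D C)

variable {regular phaseS bad cure point} {W : Scheme.{u}} {hW : IsLocallyNoetherian W} {N : ℕ} {ν : ℕ → ℕ} {L : Labelling W}
  {P : Option (Pending W)} {E : Boundary W} {D : Closeds W} {C : W.IdealSheafData}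

/-- Unfolding (`Iff.rfl`). [folklore] -/
theorem SurfacePrep.ofRecord_iff :
    SurfacePrep.ofRecord regular phaseS bad cure point W hW N ν L P E D C ↔
      (¬ regular W D ∧ phaseS W hW N ν L P E D C) ∨ (regular W D ∧ 0 < bad W E D ∧ cure W hW N ν L P E D C) ∨
        (regular W D ∧ bad W E D = 0 ∧ point W hW N ν L P E D C) :=
  Iff.rfl

/-- PHASE S's proposal is the prep proposal on a singular surface. [folklore] -/
theorem SurfacePrep.ofRecord_of_phaseS (hD : ¬ regular W D) (h : phaseS W hW N ν L P E D C) :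
    SurfacePrep.ofRecord regular phaseS bad cure point W hW N ν L P E D C :=
  Or.inl ⟨hD, h⟩

/-- The cure's proposal is the prep proposal on a regular surface with a bad trace list. [folklore] -/
theorem SurfacePrep.ofRecord_of_cure (hD : regular W D) (hM : 0 < bad W E D) (h : cure W hW N ν L P E D C) :
    SurfacePrep.ofRecord regular phaseS bad cure point W hW N ν L P E D C :=
  Or.inr (Or.inl ⟨hD, hM, h⟩)

/-- The point step's proposal is the prep proposal on a regular surface with a good trace list. [folklore] -/
theorem SurfacePrep.ofRecord_of_point (hD : regular W D) (hM : bad W E D = 0) (h : point W hW N ν L P E D C) :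
    SurfacePrep.ofRecord regular phaseS bad cure point W hW N ν L P E D C :=
  Or.inr (Or.inr ⟨hD, hM, h⟩)

/-- **The `hprep` obligation of `surfacePhase_isStratumDisciplined` SPLITS over the three sub-oracles**: if PHASE S centres (on singular surface
components), cure curves (on regular ones with `M > 0`) and F-75 points (on regular ones with `M = 0`) are regular and inside `X(ν)`, so is every centre
of the combined prep oracle. [folklore] -/
theorem SurfacePrep.ofRecord_regular_subset
    (hS : ∀ (W : Scheme.{u}) (hW : IsLocallyNoetherian W) (L : Labelling W) (P : Option (Pending W)) (E : Boundary W) (D : Closeds W)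
      (C : W.IdealSheafData), (D : Set W) ∈ surfaceComponents W N ν → ¬ regular W D → phaseS W hW N ν L P E D C →
        Scheme.IsRegular C.subscheme ∧ (C.support : Set W) ⊆ Scheme.hsStratum W N ν)
    (hcure : ∀ (W : Scheme.{u}) (hW : IsLocallyNoetherian W) (L : Labelling W) (P : Option (Pending W)) (E : Boundary W) (D : Closeds W)
      (C : W.IdealSheafData), (D : Set W) ∈ surfaceComponents W N ν → regular W D → 0 < bad W E D → cure W hW N ν L P E D C →
        Scheme.IsRegular C.subscheme ∧ (C.support : Set W) ⊆ Scheme.hsStratum W N ν)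
    (hpoint : ∀ (W : Scheme.{u}) (hW : IsLocallyNoetherian W) (L : Labelling W) (P : Option (Pending W)) (E : Boundary W) (D : Closeds W)
      (C : W.IdealSheafData), (D : Set W) ∈ surfaceComponents W N ν → regular W D → bad W E D = 0 → point W hW N ν L P E D C →
        Scheme.IsRegular C.subscheme ∧ (C.support : Set W) ⊆ Scheme.hsStratum W N ν) :
    ∀ (W : Scheme.{u}) (hW : IsLocallyNoetherian W) (L : Labelling W) (P : Option (Pending W)) (E : Boundary W) (D : Closeds W)
      (C : W.IdealSheafData), (D : Set W) ∈ surfaceComponents W N ν → SurfacePrep.ofRecord regular phaseS bad cure point W hW N ν L P E D C →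
        Scheme.IsRegular C.subscheme ∧ (C.support : Set W) ⊆ Scheme.hsStratum W N ν := by
  intro W hW L P E D C hD h
  rcases h with ⟨hr, hs⟩ | ⟨hr, hM, hc⟩ | ⟨hr, hM, hp⟩
  · exact hS W hW L P E D C hD hr hs
  · exact hcure W hW L P E D C hD hr hM hc
  · exact hpoint W hW L P E D C hD hr hM hp

end Prep

/-! ## The (P1) tier of record -/

section OfRecord

variable (Ready : SurfaceReadiness.{u}) (regular : SurfaceRegularity.{u}) (phaseS : SurfacePrep.{u}) (bad : SurfaceBadness.{u})
  (cure point : SurfacePrep.{u})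

/-- [OURS · L1 W4.2] **THE (P1) TIER OF RECORD**: `surfacePhase` with the prep oracle assembled by the case rule. (Readiness of record —
`ReadyOfRecord` of res-type-067's LAYER 2: regular ∧ `SncListOn` — and the three sub-oracles are the parameters still to be instantiated.) NOT a statement
of the manuscript. [folklore] -/
def StrategyE.surfacePhaseOfRecord : StrategyE.{u} :=
  StrategyE.surfacePhase Ready (SurfacePrep.ofRecord regular phaseS bad cure point)

variable {Ready regular phaseS bad cure point} {N : ℕ} {ν : ℕ → ℕ}

/-- Unfolding (`rfl`). [folklore] -/
theorem StrategyE.surfacePhaseOfRecord_eq :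
    StrategyE.surfacePhaseOfRecord Ready regular phaseS bad cure point =
      StrategyE.surfacePhase Ready (SurfacePrep.ofRecord regular phaseS bad cure point) :=
  rfl

/-- The (P1) tier of record is functional. [folklore] -/
theorem StrategyE.surfacePhaseOfRecord_isFunctional (Ready : SurfaceReadiness.{u}) (regular : SurfaceRegularity.{u}) (phaseS : SurfacePrep.{u})
    (bad : SurfaceBadness.{u}) (cure point : SurfacePrep.{u}) (N : ℕ) (ν : ℕ → ℕ) :
    (StrategyE.surfacePhaseOfRecord Ready regular phaseS bad cure point).IsFunctional N ν :=
  StrategyE.surfacePhase_isFunctional _ _ N ν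

/-- **THE (P1) TIER OF RECORD IS STRATUM-DISCIPLINED** from: readiness ⇒ regular as a subscheme; PHASE S / cure / point centres regular and inside `X(ν)`
on their respective cases. [folklore] -/
theorem StrategyE.surfacePhaseOfRecord_isStratumDisciplined
    (hReady : ∀ (W : Scheme.{u}) (E : Boundary W) (D : Closeds W), (D : Set W) ∈ surfaceComponents W N ν → Ready W E N ν D →
      Scheme.IsRegular (menuCentre D).subscheme)
    (hS : ∀ (W : Scheme.{u}) (hW : IsLocallyNoetherian W) (L : Labelling W) (P : Option (Pending W)) (E : Boundary W) (D : Closeds W)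
      (C : W.IdealSheafData), (D : Set W) ∈ surfaceComponents W N ν → ¬ regular W D → phaseS W hW N ν L P E D C →
        Scheme.IsRegular C.subscheme ∧ (C.support : Set W) ⊆ Scheme.hsStratum W N ν)
    (hcure : ∀ (W : Scheme.{u}) (hW : IsLocallyNoetherian W) (L : Labelling W) (P : Option (Pending W)) (E : Boundary W) (D : Closeds W)
      (C : W.IdealSheafData), (D : Set W) ∈ surfaceComponents W N ν → regular W D → 0 < bad W E D → cure W hW N ν L P E D C →
        Scheme.IsRegular C.subscheme ∧ (C.support : Set W) ⊆ Scheme.hsStratum W N ν)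
    (hpoint : ∀ (W : Scheme.{u}) (hW : IsLocallyNoetherian W) (L : Labelling W) (P : Option (Pending W)) (E : Boundary W) (D : Closeds W)
      (C : W.IdealSheafData), (D : Set W) ∈ surfaceComponents W N ν → regular W D → bad W E D = 0 → point W hW N ν L P E D C →
        Scheme.IsRegular C.subscheme ∧ (C.support : Set W) ⊆ Scheme.hsStratum W N ν) :
    (StrategyE.surfacePhaseOfRecord Ready regular phaseS bad cure point).IsStratumDisciplined N ν :=
  StrategyE.surfacePhase_isStratumDisciplined hReady (SurfacePrep.ofRecord_regular_subset hS hcure hpoint)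

end OfRecord

/-! ## The (P1) tier WITH THE READINESS OF RECORD (res-type-067's LAYER 2 `ReadyOfRecord`, p540435) -/

section Ready

variable (regular : SurfaceRegularity.{u}) (phaseS : SurfacePrep.{u}) (bad : SurfaceBadness.{u}) (cure point : SurfacePrep.{u})

/-- [OURS · L1 W4.2] **THE (P1) TIER WITH THE READINESS OF RECORD** (RULING v3.14-36 (IA): `ReadyOfRecord W E N ν D` ⟺ `(menuCentre D).subscheme`
regular ∧ the filtered boundary traces snc on it, res-type-067 p540435): `surfacePhaseOfRecord ReadyOfRecord regular phaseS bad cure point`. The three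
prep sub-oracles, the regularity reading and the badness count remain parameters. NOT a statement of the manuscript. [folklore] -/
def StrategyE.surfacePhaseReady : StrategyE.{u} :=
  StrategyE.surfacePhaseOfRecord ReadyOfRecord regular phaseS bad cure point

variable {regular phaseS bad cure point} {N : ℕ} {ν : ℕ → ℕ}

/-- Unfolding (`rfl`). [folklore] -/
theorem StrategyE.surfacePhaseReady_eq :
    StrategyE.surfacePhaseReady regular phaseS bad cure point = StrategyE.surfacePhaseOfRecord ReadyOfRecord regular phaseS bad cure point :=
  rfl

/-- The (P1) tier with the readiness of record is functional. [folklore] -/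
theorem StrategyE.surfacePhaseReady_isFunctional (regular : SurfaceRegularity.{u}) (phaseS : SurfacePrep.{u}) (bad : SurfaceBadness.{u})
    (cure point : SurfacePrep.{u}) (N : ℕ) (ν : ℕ → ℕ) : (StrategyE.surfacePhaseReady regular phaseS bad cure point).IsFunctional N ν :=
  StrategyE.surfacePhaseOfRecord_isFunctional _ _ _ _ _ _ N ν

/-- **THE (P1) TIER WITH THE READINESS OF RECORD IS STRATUM-DISCIPLINED** once the three prep sub-oracles propose regular centres inside `X(ν)` on their
cases — the readiness half `hReady` is DISCHARGED by res-type-067's `ReadyOfRecord.isRegular`. [folklore] -/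
theorem StrategyE.surfacePhaseReady_isStratumDisciplined
    (hS : ∀ (W : Scheme.{u}) (hW : IsLocallyNoetherian W) (L : Labelling W) (P : Option (Pending W)) (E : Boundary W) (D : Closeds W)
      (C : W.IdealSheafData), (D : Set W) ∈ surfaceComponents W N ν → ¬ regular W D → phaseS W hW N ν L P E D C →
        Scheme.IsRegular C.subscheme ∧ (C.support : Set W) ⊆ Scheme.hsStratum W N ν)
    (hcure : ∀ (W : Scheme.{u}) (hW : IsLocallyNoetherian W) (L : Labelling W) (P : Option (Pending W)) (E : Boundary W) (D : Closeds W)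
      (C : W.IdealSheafData), (D : Set W) ∈ surfaceComponents W N ν → regular W D → 0 < bad W E D → cure W hW N ν L P E D C →
        Scheme.IsRegular C.subscheme ∧ (C.support : Set W) ⊆ Scheme.hsStratum W N ν)
    (hpoint : ∀ (W : Scheme.{u}) (hW : IsLocallyNoetherian W) (L : Labelling W) (P : Option (Pending W)) (E : Boundary W) (D : Closeds W)
      (C : W.IdealSheafData), (D : Set W) ∈ surfaceComponents W N ν → regular W D → bad W E D = 0 → point W hW N ν L P E D C →
        Scheme.IsRegular C.subscheme ∧ (C.support : Set W) ⊆ Scheme.hsStratum W N ν) :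
    (StrategyE.surfacePhaseReady regular phaseS bad cure point).IsStratumDisciplined N ν :=
  StrategyE.surfacePhaseOfRecord_isStratumDisciplined (fun _ _ _ _ h => h.isRegular) hS hcure hpoint

end Ready

/-! ## Between cycles: the policy is silent while a CJS cycle is pending (cycle atomicity for (L-A)) -/

section BetweenCycles

variable {M : CentreMenu.{u}} {N : ℕ} {ν : ℕ → ℕ} {π : StrategyE.{u}} {W : Scheme.{u}} {hW : IsLocallyNoetherian W} {L : Labelling W}
  {P : Option (Pending W)} {E : Boundary W}

/-- [OURS · L1 W4.2] **THE POLICY RESTRICTED TO STATES BETWEEN CJS CYCLES** (`P = none`): a designed step is allowed only when no replay cycle of the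
fallback is pending, so a started cycle is continued by the fallback to its end (cycle ATOMICITY — what Ω's label-fairness argument for the (L-A) socket
`TauRecurrentWaitingImpossible` needs; RULING (D-iii) «π-steps emit `P′ = none`» then never drops a pending datum). NOT a statement of the manuscript. [folklore] -/
def StrategyE.betweenCycles (π : StrategyE.{u}) : StrategyE.{u} :=
  ⟨fun W hW N ν L P E C P' => P = none ∧ π.step W hW N ν L P E C P'⟩

/-- Unfolding (`Iff.rfl`). [folklore] -/
theorem StrategyE.betweenCycles_step_iff {C : W.IdealSheafData} {P' : Option (Pending (blowup C))} :
    π.betweenCycles.step W hW N ν L P E C P' ↔ P = none ∧ π.step W hW N ν L P E C P' :=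
  Iff.rfl

/-- A step of the restricted policy is a step of the policy. [folklore] -/
theorem StrategyE.betweenCycles_step_imp {C : W.IdealSheafData} {P' : Option (Pending (blowup C))}
    (h : π.betweenCycles.step W hW N ν L P E C P') : π.step W hW N ν L P E C P' :=
  h.2

/-- The restricted policy is SILENT mid-cycle. [folklore] -/
theorem StrategyE.betweenCycles_silent_of_pending {Q : Pending W} {C : W.IdealSheafData} {P' : Option (Pending (blowup C))} :
    ¬ π.betweenCycles.step W hW N ν L (some Q) E C P' :=
  fun h => Option.some_ne_none Q h.1

/-- Between cycles the restricted policy speaks iff the policy does. [folklore] -/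
theorem StrategyE.betweenCycles_exists_step_iff :
    (∃ (C : W.IdealSheafData) (P' : Option (Pending (blowup C))), π.betweenCycles.step W hW N ν L P E C P') ↔
      P = none ∧ ∃ (C : W.IdealSheafData) (P' : Option (Pending (blowup C))), π.step W hW N ν L P E C P' := by
  constructor
  · rintro ⟨C, P', hP, h⟩
    exact ⟨hP, C, P', h⟩
  · rintro ⟨hP, C, P', h⟩
    exact ⟨C, P', hP, h⟩

/-- **Functionality passes to the restriction.** [folklore] -/
theorem StrategyE.IsFunctional.betweenCycles (h : π.IsFunctional N ν) : π.betweenCycles.IsFunctional N ν :=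
  fun W hW L P E =>
    ⟨fun C₁ C₂ P₁ P₂ h₁ h₂ => (h W hW L P E).1 C₁ C₂ P₁ P₂ h₁.2 h₂.2, fun C P₁ P₂ h₁ h₂ => (h W hW L P E).2 C P₁ P₂ h₁.2 h₂.2⟩

/-- **`M`-discipline passes to the restriction** (fewer steps; in particular STRATUM discipline). [folklore] -/
theorem StrategyE.IsDisciplinedBy.betweenCycles (h : π.IsDisciplinedBy M N ν) : π.betweenCycles.IsDisciplinedBy M N ν :=
  fun W hW L P E C P' hs => h W hW L P E C P' hs.2

/-- Stratum discipline passes to the restriction. [folklore] -/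
theorem StrategyE.IsStratumDisciplined.betweenCycles (h : π.IsStratumDisciplined N ν) : π.betweenCycles.IsStratumDisciplined N ν :=
  StrategyE.IsDisciplinedBy.betweenCycles h

end BetweenCycles

/-! ## The (P1) tier WITH THE TRUE-SET READINESS OF RECORD (res-type-067's LAYER 2 rev 2 `ReadyTSOfRecord`, p542978; appended 2026-08-27 g9) -/

section ReadyTS

variable (regular : SurfaceRegularity.{u}) (phaseS : SurfacePrep.{u}) (bad : SurfaceBadness.{u}) (cure point : SurfacePrep.{u})

/-- [OURS · L1 W4.2] **THE (P1) TIER WITH THE TRUE-SET READINESS OF RECORD** (`ReadyTSOfRecord` = regular ∧ filtered traces snc ∧ NO REPEATED trace —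
CJS's «true set» clause, res-L1-w42-tri-2 R11-BR (V5), res-type-067 rev 2 p542978; the readiness instance of record from rev 2 on):
`surfacePhaseOfRecord ReadyTSOfRecord regular phaseS bad cure point`. Supersedes `surfacePhaseReady` as the instance of record (the rev-1 readiness
`ReadyOfRecord` stays a weaker predicate: `ReadyTSOfRecord.readyOfRecord`). NOT a statement of the manuscript. [folklore] -/
def StrategyE.surfacePhaseReadyTS : StrategyE.{u} :=
  StrategyE.surfacePhaseOfRecord ReadyTSOfRecord regular phaseS bad cure point

variable {regular phaseS bad cure point} {N : ℕ} {ν : ℕ → ℕ}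

/-- Unfolding (`rfl`). [folklore] -/
theorem StrategyE.surfacePhaseReadyTS_eq :
    StrategyE.surfacePhaseReadyTS regular phaseS bad cure point = StrategyE.surfacePhaseOfRecord ReadyTSOfRecord regular phaseS bad cure point :=
  rfl

/-- The (P1) tier with the true-set readiness is functional. [folklore] -/
theorem StrategyE.surfacePhaseReadyTS_isFunctional (regular : SurfaceRegularity.{u}) (phaseS : SurfacePrep.{u}) (bad : SurfaceBadness.{u})
    (cure point : SurfacePrep.{u}) (N : ℕ) (ν : ℕ → ℕ) : (StrategyE.surfacePhaseReadyTS regular phaseS bad cure point).IsFunctional N ν :=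
  StrategyE.surfacePhaseOfRecord_isFunctional _ _ _ _ _ _ N ν

/-- **THE (P1) TIER WITH THE TRUE-SET READINESS IS STRATUM-DISCIPLINED** once the three prep sub-oracles propose regular centres inside `X(ν)` on their
cases — `hReady` DISCHARGED by res-type-067's `ReadyTSOfRecord.isRegular`. [folklore] -/
theorem StrategyE.surfacePhaseReadyTS_isStratumDisciplined
    (hS : ∀ (W : Scheme.{u}) (hW : IsLocallyNoetherian W) (L : Labelling W) (P : Option (Pending W)) (E : Boundary W) (D : Closeds W)
      (C : W.IdealSheafData), (D : Set W) ∈ surfaceComponents W N ν → ¬ regular W D → phaseS W hW N ν L P E D C →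
        Scheme.IsRegular C.subscheme ∧ (C.support : Set W) ⊆ Scheme.hsStratum W N ν)
    (hcure : ∀ (W : Scheme.{u}) (hW : IsLocallyNoetherian W) (L : Labelling W) (P : Option (Pending W)) (E : Boundary W) (D : Closeds W)
      (C : W.IdealSheafData), (D : Set W) ∈ surfaceComponents W N ν → regular W D → 0 < bad W E D → cure W hW N ν L P E D C →
        Scheme.IsRegular C.subscheme ∧ (C.support : Set W) ⊆ Scheme.hsStratum W N ν)
    (hpoint : ∀ (W : Scheme.{u}) (hW : IsLocallyNoetherian W) (L : Labelling W) (P : Option (Pending W)) (E : Boundary W) (D : Closeds W)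
      (C : W.IdealSheafData), (D : Set W) ∈ surfaceComponents W N ν → regular W D → bad W E D = 0 → point W hW N ν L P E D C →
        Scheme.IsRegular C.subscheme ∧ (C.support : Set W) ⊆ Scheme.hsStratum W N ν) :
    (StrategyE.surfacePhaseReadyTS regular phaseS bad cure point).IsStratumDisciplined N ν :=
  StrategyE.surfacePhaseOfRecord_isStratumDisciplined (fun _ _ _ _ h => h.isRegular) hS hcure hpoint

end ReadyTS

end Summit.ResolutionOfSingularities.ResolutionOfSingularities.Theorems.SigmaMaxModificationsCorridor3.Sigma

end
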